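import Summits.QuantumFields.BalabanUV.T4Continuum.Support.B16HistoryTowerExtractionEnd2
import Summits.QuantumFields.BalabanUV.T4Continuum.Support.B16HistoryTowerExtractionEnd3
import Literature.MathematicalPhysics.QuantumFieldTheory.Balaban1983to89.T4BadClassBooking

/-!
# BalabanUVNodes ∕ N20 knit, part 2 — node N20 = NE7b (`T4WeightBudget.RelWeightBound`) BY NAME at the (α) road's tower records WITH THE
# COUNT DERIVED: N20 ⇐ {the extraction displays + the PRICE SENTENCES of print's KIND} (IR-103-2), resp. ⇐ {local conditional stability + the
# window ledgers} (IR-104-2), under `BetaPertHyp` and the END's constants — NO cell-count binder (Track A, DAG node N20; cluster K5)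

HONEST FRAMING.  Count-neutral kernel bookkeeping BY NAME over LANDED hypothesis shapes of the cell `pub-balaban` (row NE7b; owner lineage
`t4-ne7b-p1`; typists leaf-06 (IR-103-2 `B16HistoryTowerExtractionPricedDataLWR` ∕ `…ExtractionEnd2`), leaf-06 again for `Spine/NE7b/RealisedPinnedRelPDWTL`
(the pinned `_rel` END over leaf-01's P∕W∕T chain), `pub-balaban-gaps` ne6 (IR-104-2 `…ExtractionStepDataLWR` ∕ `…ExtractionEnd3`)); NOT a node discharge (no NODE 00 stage
pins N20's carriers; (α)-instance 0∕1; NC-NE7b-α UNRULED).  NE7b is the cell's OWN estimate: NOT PRINTED in [Bałaban 1983–89], NOT PROVED;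
printed MODEL [King1986] (3.10)–(3.11) p. 656.  One finite four-torus at fixed ε; nothing continuum ∕ ℝ⁴ ∕ OS ∕ mass-gap ∕ Clay.  0 `sorry`,
0 `def`, standard axioms.  Part 1 = `BalabanUVNodesN20Knit` (N20 at exact carriers from two runs' `ExtractionLaws`; at the IR-103-1 record; at the
IR-103-2 ∕ IR-104-2 records with the count DISPLAYED).

WHAT THIS PART ADDS.  On the IR-103-2 road the cell's COUNT in relative currency is not displayed: the pinned `_rel` END
`NE7b.RealisedPinnedRelPDWTL.hybridNE7_of_realisedDomainsRunW_pinnedT3bPDTL_rel` DERIVES it from the PRICE SENTENCES `priceA ∕ priceB` («the relative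
quotient of a pinned live key family is at most its PRINTED PRICE» — [Balaban1989LargeFieldII] Thm 1's upper half (1.79)–(1.89) read per pinned old
genealogy: print's KIND, NOT print's statement) through the cell's multiplicity socket, and returns `HybridNE7` (N19 ∧ N20 ∧ N21 jointly) for the
families shifted by `K₁ + K₂`, weight `1 · recordsBudget (birthMass C) C.κ₁ (n^d) (L^d) (log 2) jhalf`.  `B16HistoryTowerExtractionEnd2` states only
the `ForSmallCouplings` ∕ apex form (`hybridNE7Under_of_towerExtractionPriced_fsc`).  Here: the SAME plumbing PER RECORD, projected to N20 —
§1 `relWeightBound_of_towerExtractionPriced_derived`: under `BetaPertHyp D.βfun` and the END's constants, for all small couplings `γ ≤ γ₁`,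
`g ≤ g₁`, every tuned bare sequence `g₀`, every loop string `os` and EVERY record `Sp : TowerExtractionPricedDataLWR … g₀ os …`: `∃ K₁ K₂`,
`Sp.K₀ ≤ K₁`, `RelWeightBound Sp.l₀` at the `(K₁ + K₂)`-shifted tower carriers with the budget's own bad set and the weight above, VERBATIM;
§2 `relWeightBound_of_towerExtractionStep_derived`: the same one step deeper, for every record `Sd : TowerExtractionStepDataLWR …` of ne6's
IR-104-2 (through `B16HistoryTowerExtractionEnd3.toPriced`: the extraction displays DERIVED from `LocCondStability` per pinned event, the price
sentences = the window ledgers `ledgerA ∕ ledgerB` at the derived quotients `exp Σ_{j<K} (b − a)`).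
HONEST READING of §2: N20 at the tower ⇐ [`BetaPertHyp` ∧ constants ∧ per bad key along the key patterns: `pwA ∕ pwB` (pointwise extraction,
[Balaban1989LargeFieldI] (0.1) p. 175 — by definition of the regions), **`lcsA ∕ lcsB`** (local conditional stability — THE residual of Bałaban's
KIND, [Balaban1989LargeFieldI] (0.3)–(0.5) pp. 176–177), **`ledgerA ∕ ledgerB`** (the window ledgers in print's price currency), the step-kernel
identities, the reading's clauses, print's per-step sentences — DISPLAYED as record rows; NE7c's `shell`, NE7's `budget` and four rates are
rows of the same record and are READ by the END (the count is derived jointly), though `RelWeightBound` itself names none of them].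
IN-EDGES (YM-PLAN §2c row NE7b): N13 ([B16] (1.79)–(1.89) pp. 383–387) ↔ `extractA∕B` ∕ `lcsA∕B` + `priceA∕B` ∕ `ledgerA∕B`; N12 ([B15] p. 177
(i)∕(ii), the renormalisation window) ↔ the END's window bookkeeping (`recordsBudget`, `jhalf`); NODE 00 ∕ (A1c) ↔ the carriers (none pinned).
WHAT HAS NO TREE PRODUCER: inhabitants of those rows for Bałaban's tower; the tower object itself (owner WALL `ROW-NE7b-STATE.md` v1.76 §3).

GUARDS (§3, vacuity audit in kernel form).  (G1) the hypothesis list of part 1's §1 knit `N20Knit.relWeightBound_of_extractionLaws` — two runs'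
`ExtractionLaws` over the same bad classes + quotient totals `≤ W` + `W < 1` + `Σ W < ∞` — is JOINTLY INHABITED WITH A NONEMPTY BAD CLASS at every
cutoff (`extractionLaws_toy`, `toy_side_conditions`, `relWeightBound_toy`, `toy_bad_nonempty`): the knit does not conclude by contradiction; (G2) the
node statement is NOT FOR FREE: on the same two-term family with a non-decaying bad weight the class is SATURATED and NO weight sequence books it,
whatever the second run (`not_exists_relWeightBound_toy_saturated`, by `T4BadClassBooking.not_exists_relWeightBound_of_saturated`) — N20's content is
the SUMMABLE DECAY of the old classes' relative weight; (G3, typing note for the K5 record predicate, no theorem) the EMPTY class is free for ANY two runs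
(`T4LipschitzLedgerSocket.relWeightBound_noBad`), and then N19's `Spine.NE7.Core` on `T K ∖ ∅` is the whole two-run matching — so `SRec` must pin
`S.Bad` to the budget's OWN saturated bad set of the reading (`badOfClass (bstrOf …) … (badClasses … jhalf …)`, the terms with live structure older
than `⌊K∕2⌋`), else `S_N20` is dischargeable vacuously while N19 silently absorbs NE7b; likewise (`relWeightBound_of_radius_neg`) a NEGATIVE radius
`l₀ < 0` voids every `∀ t`-clause, so `SRec` must pin `0 < S.l₀` (the records carry `l₀_pos`, `SpineDatum` the conjunct `0 < l₀`).

Sources: T. Bałaban, CMP **122** (1989) [Balaban1989LargeFieldI] (0.1)–(0.5) pp. 175–177, p. 177 (i)∕(ii); [Balaban1989LargeFieldII] (1.72)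
p. 379, (1.79)–(1.89) pp. 383–387; C. King, CMP **102** (1986) [King1986] (3.10)–(3.11) p. 656.  Nothing here is a claim about the mass gap.
-/

open Finset MeasureTheory
open Literature.MathematicalPhysics.QuantumFieldTheory.Balaban1983to89
open T4PersistenceDictionary T4PersistentHistoryCount T4BankedInduction T4PrintedShapeBanking
open T4WeightBudget T4GlobalDenominator T4LiveClassFibration T4LiveStructureGas T4LiveGasToTerms T4RecordPriceSeam
open T4PartnerMultiplicity T4IndicatorShell T4MatchingAssembly T4MatchingClosure T4MatchingClosureSocket T4Continuum
open Finset MeasureTheory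
open Literature.MathematicalPhysics.QuantumFieldTheory.Balaban1983to89
open T4PersistenceDictionary T4PersistentHistoryCount T4BankedInduction T4PrintedShapeBanking
open T4WeightBudget T4GlobalDenominator T4LiveClassFibration T4LiveStructureGas T4LiveGasToTerms T4RecordPriceSeam
open T4PartnerMultiplicity T4IndicatorShell T4MatchingAssembly T4MatchingClosure T4MatchingClosureSocket T4Continuum
open T4StabilitySocket T4BranchingRecordsGas T4TaggedShapeBanking T4CanonicalMenus T4RenewalChains
open Summit.QuantumFields.BalabanUV.T4Continuum.PlacementBatch
open Summit.QuantumFields.BalabanUV.T4Continuum.PlacementSkeleton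
open Summit.QuantumFields.BalabanUV.T4Continuum.CountThresholdUniform
open Summit.QuantumFields.BalabanUV.T4Continuum.CountThresholdExit
open Summit.QuantumFields.BalabanUV.T4Continuum.CountSeamJunction
open Summit.QuantumFields.BalabanUV.T4Continuum.LateMergers
open Summit.QuantumFields.BalabanUV.T4Continuum.HistoryFlow
open Summit.QuantumFields.BalabanUV.T4Continuum.HistoryRegeneration
open Summit.QuantumFields.BalabanUV.T4Continuum.HistoryTables
open Summit.QuantumFields.BalabanUV.T4Continuum.HistoryAssemblyTrees
open Summit.QuantumFields.BalabanUV.T4Continuum.HistoryAssemblyTerms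
open Summit.QuantumFields.BalabanUV.T4Continuum.HistoryAssemblyPedigree
open Summit.QuantumFields.BalabanUV.T4Continuum.HistoryConstants
open Summit.QuantumFields.BalabanUV.T4Continuum.HistoryGen
open Literature.MathematicalPhysics.QuantumFieldTheory.Balaban1983to89.B13ScaleTransfer
open Summit.QuantumFields.BalabanUV.T4Continuum.ZoneSkeleton
open Summit.QuantumFields.BalabanUV.T4Continuum.HistorySocketTH
open Summit.QuantumFields.BalabanUV.T4Continuum.HistoryCaps
open Summit.QuantumFields.BalabanUV.T4Continuum.HistoryAssemblyPrice
open Summit.QuantumFields.BalabanUV.T4Continuum.HistoryBankingLE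
open Summit.QuantumFields.BalabanUV.T4Continuum.HistoryExitLE
open Summit.QuantumFields.BalabanUV.T4Continuum.HistoryAssemblyTreesLE
open Summit.QuantumFields.BalabanUV.T4Continuum.HistoryAssemblyTermsLE
open Summit.QuantumFields.BalabanUV.T4Continuum.HistoryRealise
open Summit.QuantumFields.BalabanUV.T4Continuum.HistoryAssemblyRealiseLE
open Summit.QuantumFields.BalabanUV.T4Continuum.HistoryAssemblyMult
open Summit.QuantumFields.BalabanUV.T4Continuum.HistoryAssemblyMultKey
open Summit.QuantumFields.BalabanUV.T4Continuum.HistoryAssemblyRealiseRun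
open Summit.QuantumFields.BalabanUV.T4Continuum.HistoryAssemblyRealiseMult
open Summit.QuantumFields.BalabanUV.T4Continuum.HistoryZones
open Summit.QuantumFields.BalabanUV.T4Continuum.HistoryRealiseCells
open Summit.QuantumFields.BalabanUV.T4Continuum.HistoryRealiseCellsRun
open Summit.QuantumFields.BalabanUV.T4Continuum.HistoryAssemblyRealiseRunMult
open Summit.QuantumFields.BalabanUV.T4Continuum.HistoryRealiseCellsRunMult
open Summit.QuantumFields.BalabanUV.T4Continuum.HistoryAssemblyMultInstance
open Summit.QuantumFields.BalabanUV.T4Continuum.HistoryJoinsPlacedMember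
open Summit.QuantumFields.BalabanUV.T4Continuum.PlacementSkeleton
open Summit.QuantumFields.BalabanUV.T4Continuum.HistoryJoinsPlacedMult
open Summit.QuantumFields.BalabanUV.T4Continuum.HistoryRealiseDistinct
open Summit.QuantumFields.BalabanUV.T4Continuum.HistoryRegionTemplates
open Summit.QuantumFields.BalabanUV.T4Continuum.HistoryCaps
open Summit.QuantumFields.BalabanUV.T4Continuum.HistoryZoneEvolve (cth)
open Literature.MathematicalPhysics.QuantumFieldTheory.Balaban1983to89.B16SProfile (DropCtl)
open Summit.QuantumFields.BalabanUV.T4Continuum.HistoryRealiseCellsRunMultEnd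
open Summit.QuantumFields.BalabanUV.T4Continuum.HistoryRealiseCellsRunMultP
open Summit.QuantumFields.BalabanUV.T4Continuum.HistoryRealiseCellsRunMultEndP
open Summit.QuantumFields.BalabanUV.T4Continuum.HistoryRealisePrint
open Summit.QuantumFields.BalabanUV.T4Continuum.HistoryRealiseWeak
open Summit.QuantumFields.BalabanUV.T4Continuum.HistoryRealiseWeakReading
open Summit.QuantumFields.BalabanUV.T4Continuum.HistoryRealiseWeakCells
open Summit.QuantumFields.BalabanUV.T4Continuum.HistoryAssemblyRealiseRunMultW
open Summit.QuantumFields.BalabanUV.T4Continuum.HistoryAssemblyRealiseRunMultPWT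
open Summit.QuantumFields.BalabanUV.T4Continuum.HistoryAssemblyMultInstanceW
open Summit.QuantumFields.BalabanUV.T4Continuum.HistoryRealiseCellsRunMultW
open Summit.QuantumFields.BalabanUV.T4Continuum.HistoryRealiseCellsRunMultPWT
open Summit.QuantumFields.BalabanUV.T4Continuum.HistoryRealiseCellsRunMultEndW
open Summit.QuantumFields.BalabanUV.T4Continuum.HistoryRealiseCellsRunMultEndDW
open Summit.QuantumFields.BalabanUV.T4Continuum.HistoryRealiseCellsRunMultEndPWT
open Summit.QuantumFields.BalabanUV.T4Continuum.HistoryRealiseCellsRunMultEndPD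
open Summit.QuantumFields.BalabanUV.T4Continuum.HistoryRealiseDistinctGuarded
open Summit.QuantumFields.BalabanUV.T4Continuum.HistoryAssemblyMultInstanceWL
open Summit.QuantumFields.BalabanUV.T4Continuum.NE7b.RealisedEndRelPWT
open Summit.QuantumFields.BalabanUV.T4Continuum.HistoryRealiseCellsRunMultEndPDWTL
open Summit.QuantumFields.BalabanUV.T4Continuum.HistoryRealiseCellsRunApexT3b Summit.QuantumFields.BalabanUV.T4Continuum.HistoryGenealogyRealise
open Summit.QuantumFields.BalabanUV.T4Continuum.HistoryGenealogyInstantiate Summit.QuantumFields.BalabanUV.T4Continuum.B16HistoryIndexedRepr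
open Summit.QuantumFields.BalabanUV.T4Continuum.B16HistoryIndexedTrunc Summit.QuantumFields.BalabanUV.T4Continuum.HistoryRealiseCellsRunAssemblyWTVSData
open Summit.QuantumFields.BalabanUV.T4Continuum.B16HistoryReprChain Summit.QuantumFields.BalabanUV.T4Continuum.B16HistoryReprInstance
open Summit.QuantumFields.BalabanUV.T4Continuum.B16HistoryReprRead Summit.QuantumFields.BalabanUV.T4Continuum.B16HistoryReprReadCausal
open Summit.QuantumFields.BalabanUV.T4Continuum.NE7b.RealisedEndRelPDWTL
open Summit.QuantumFields.BalabanUV.T4Continuum.NE7b.RealisedPinnedRelPDWTL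
open Summit.QuantumFields.BalabanUV.T4Continuum.B16HistoryTowerExtractionPricedDataLWR
open Summit.QuantumFields.BalabanUV.T4Continuum.B16HistoryTowerExtractionEnd2
open Summit.QuantumFields.BalabanUV.T4Continuum.B16HistoryTowerExtractionStepDataLWR
open Summit.QuantumFields.BalabanUV.T4Continuum.B16HistoryTowerExtractionEnd3 (toPriced)

noncomputable section

namespace Summit.QuantumFields.YangMills.BalabanUVNodes.N20KnitDerived

set_option synthInstance.maxSize 1024

/-! ## §1 N20 at the IR-103-2 record, count DERIVED from the price sentences (per record, under `BetaPertHyp` + constants) -/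

section Priced

variable {F : T4Family} {G : Type*} [GaugeGroup G] [MeasurableSpace G] [HaarData G]

/-- **N20 · NE7b BY NAME AT THE IR-103-2 TOWER RECORD, COUNT DERIVED.**  Under the β-side pin `BetaPertHyp D.βfun` (the END's flow rows) and
the END's constants-side binders (`ThresholdOK`, `0 < C.μ`, the κ₁∕E₀ largeness, `1 ≤ A₀`, `0 < β₀`, `L·β₀ ≤ 1`, `13 ≤ n₁`, the slack
`C.a + θ ≤ ½γ₀A₁²`, `0 < E₂`, `0 ≤ E₃`, row S6g′'s stride ∕ decay arithmetic — inhabited by O(1) constants elsewhere in the cell, not here):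
there are coupling thresholds `γ₁`, `g₁` such that for every tuned bare sequence `g₀` of a run in the window, every loop string `os` and EVERY
record `Sp : TowerExtractionPricedDataLWR … g₀ os …` (rows of Bałaban's KIND: `extractA ∕ extractB`, `priceA ∕ priceB`; plus the reading, NE7c's
`shell`, NE7's `budget`, four rates — all READ by the END), for some `K₁ ≥ Sp.K₀` and `K₂` the `(K₁ + K₂)`-SHIFTED tower families satisfy
`RelWeightBound Sp.l₀ …` with the budget's OWN bad set and the weight `1 · recordsBudget (birthMass C) C.κ₁ (n^d) (L^d) (log 2) jhalf (K₁ + (K₂ + K))`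
VERBATIM.  Proof: the pinned `_rel` END fed from the record exactly as in `B16HistoryTowerExtractionEnd2.hybridNE7Under_of_towerExtractionPriced_fsc`,
then the field `HybridNE7.weight` (Q8 naming: N20 ↔ `.weight`).  CONDITIONAL on every row; nothing of Bałaban's asserted. [folklore] -/
theorem relWeightBound_of_towerExtractionPriced_derived (D : FiniteEpsData F G) (hβ : BetaPertHyp D.βfun)
    {C : T4PrintedShapeBanking.Consts} {O : PrintedO1s}
    {rr : ℕ} {β₀ : ℝ} (h : ThresholdOK C F.L rr β₀) (hμ : 0 < C.μ) (d n : ℕ)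
    (hκ₁ : (d : ℝ) * Real.log F.L + 2 * Real.log 2 ≤ C.κ₁) (hE₀ : Real.log (2 + birthMass C) ≤ C.E₀)
    (hA₀ : 1 ≤ C.A₀) (hβ₀ : 0 < β₀) (hLβ : (F.L : ℝ) * β₀ ≤ 1) (hn₁ : 13 ≤ C.n₁) (hn : 0 < n)
    {θ : ℝ} (hθ : 0 < θ) (hslack : C.a + θ ≤ O.γ₀ * O.A₁ ^ 2 / 2)
    (hE₂ : 0 < C.E₂) (hE₃ : 0 ≤ C.E₃) {sS : ℕ} (hsS : 1 ≤ sS)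
    (hsmall : (((2 * cth 32 1 sS + 1) ^ d : ℕ) : ℝ) * (5 : ℝ) ^ d * ((max 1 (2 * 32 + 2) : ℕ) : ℝ) ≤
      (F.L : ℝ) ^ (sS / 2) / 2)
    {θc : ℝ} (hθc0 : 0 ≤ θc) (hθc1 : θc < 1) (hθcs : 1 / 2 ≤ θc ^ sS) :
    ∃ γ₁ : ℝ, 0 < γ₁ ∧ ∀ γ : ℝ, 0 < γ → γ ≤ γ₁ → ∃ g₁ : ℝ, 0 < g₁ ∧ ∀ g : ℝ, 0 < g → g ≤ g₁ →
      ∀ g₀ : ℕ → ℝ, D.Tuned γ g g₀ → ∀ (os : List (ULoop F))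
        {θv cΛ M Φ b₀ : ℝ} {p₁ η η' κ κ₂ κᵥ : ℕ} {P : Type} [DecidableEq P] {X : ℕ → ℕ → Type}
        {𝒢 : (K j : ℕ) → GoodClass (X K j)} [∀ K, MeasurableSpace (X K K)] {μ : (K : ℕ) → Measure (X K K)}
        [∀ K, IsFiniteMeasure (μ K)]
        (Sp : TowerExtractionPricedDataLWR D C O θv rr d n hn g₀ os cΛ M Φ b₀ p₁ η η' κ κ₂ κᵥ P X 𝒢 μ),
      ∃ K₁ K₂, Sp.K₀ ≤ K₁ ∧ RelWeightBound Sp.l₀ (fun K => HIndex.termSet (skelFam Sp.T Sp.p₀) (K₁ + (K₂ + K)))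
        (fun _ t => Repr172R.weight μ (reprFam Sp.T Sp.p₀ Sp.ρ₀ Sp.hρ₀ Sp.h0 (fun _ _ => 1) (fun _ _ => one_pos)) t)
        (fun K => weightB μ (reprFam Sp.T Sp.p₀ Sp.ρ₀ Sp.hρ₀ Sp.h0 (fun _ _ => 1) (fun _ _ => one_pos)) Sp.trunc (K₁ + (K₂ + K)))
        (fun K => badOfClass (bstrOf Prod.fst (memA n F.L (Sp.𝒮.reading Sp.T Sp.p₀))) (HIndex.termSet (skelFam Sp.T Sp.p₀))
            (fun K _ => badClasses Prod.fst (memA n F.L (Sp.𝒮.reading Sp.T Sp.p₀)) jhalf (HIndex.termSet (skelFam Sp.T Sp.p₀)) K)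
            (K₁ + (K₂ + K)))
        (fun K => 1 * recordsBudget (birthMass C) C.κ₁ ((n : ℝ) ^ d) ((F.L : ℝ) ^ d) (Real.log 2) jhalf (K₁ + (K₂ + K))) := by
  obtain ⟨γ₁, hγ₁, H⟩ := hybridNE7_of_realisedDomainsRunW_pinnedT3bPDTL_rel D hβ h hμ d n hκ₁ hE₀ hA₀ hβ₀ hLβ hn₁ hn hθ hslack
    hE₂ hE₃ hsS hsmall hθc0 hθc1 hθcs
  refine ⟨γ₁, hγ₁, fun γ hγ hγle => ?_⟩
  obtain ⟨g₁, hg₁, Hg⟩ := H γ hγ hγle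
  refine ⟨g₁, hg₁, fun g hg hgle g₀ ht os θv cΛ M Φ b₀ p₁ η η' κ κ₂ κᵥ P _ X 𝒢 _ μ _ Sd => ?_⟩
  obtain ⟨K₁, K₂, hK₁, hH⟩ := Hg g hg hgle g₀ ht Sd.l₀ Sd.vol Sd.K₀
    (HIndex.termSet (skelFam Sd.T Sd.p₀)) (fun _ t => Repr172R.weight μ (reprFam Sd.T Sd.p₀ Sd.ρ₀ Sd.hρ₀ Sd.h0 (fun _ _ => 1) (fun _ _ => one_pos)) t)
    (weightB μ (reprFam Sd.T Sd.p₀ Sd.ρ₀ Sd.hρ₀ Sd.h0 (fun _ _ => 1) (fun _ _ => one_pos)) Sd.trunc) Sd.shA Sd.shB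
    Sd.Cc Sd.Rr Sd.CcRec Sd.RrRec Sd.ν Sd.u Sd.s₂ Sd.q₀ Sd.r Sd.s Sd.Wsh
    -- the (2.5) size function = the reading's sizes
    (Sd.𝒮.reading Sd.T Sd.p₀).R Sd.isRj Sd.one_le_R
    -- the READING: pass V's carriers, weakly realised with their domains; its clauses
    (Sd.𝒮.reading Sd.T Sd.p₀).inputOf.pedV (fun _ _ => id) (Sd.𝒮.reading Sd.T Sd.p₀).inputOf.liveCV (Sd.𝒮.reading Sd.T Sd.p₀).inputOf.ZV
    (realised_of_towerExtractionPriced Sd)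
    (fun K _ τ _ c hc => by
      obtain ⟨x, -, rfl⟩ := Finset.mem_image.1 hc
      exact le_rfl)
    (disjointJoinsL_of_towerExtractionPriced Sd) (boxedBirths_of_towerExtractionPriced Sd)
    -- the realised costs AT the model's total cost (`κ = κ′ := costT`, `le_rfl`)
    (fun K _ => costT Prod.fst C K ((Sd.𝒮.reading Sd.T Sd.p₀).R K)) (fun K _ => costT Prod.fst C K ((Sd.𝒮.reading Sd.T Sd.p₀).R K))
    (fun _ _ _ _ _ _ => le_rfl) (fun _ _ _ _ _ _ => le_rfl)
    -- the RE-CUT numerator side, FROM THE RECORD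
    (fun K t _ _ τ _ => Repr172R.weight_nonneg μ _ t (fun _ _ _ => zero_le_one) τ)
    (fun K t _ _ τ _ => weightB_nonneg μ _ Sd.trunc K t (fun _ _ _ => zero_le_one) τ)
    Sd.qA Sd.qB Sd.qA_nonneg Sd.qB_nonneg Sd.extractA (fibM'_of_extractB Sd) Sd.priceA Sd.priceB
    -- the seam's other inputs (rows of the same record, read by the END; the count is derived jointly)
    Sd.shell Sd.budget Sd.sum_r Sd.sum_u Sd.sum_s Sd.sum_s₂
  exact ⟨K₁, K₂, hK₁, hH.weight⟩

end Priced

/-! ## §2 One step deeper: N20 at ne6's IR-104-2 record (LCS + window ledgers), count DERIVED -/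

section Step

variable {F : T4Family} {G : Type*} [GaugeGroup G] [MeasurableSpace G] [HaarData G]

/-- **N20 · NE7b BY NAME ONE STEP DEEPER, COUNT DERIVED.**  As §1, for EVERY record `Sd : TowerExtractionStepDataLWR …` of the IR-104-2 road —
per bad key along its key pattern: `pwA ∕ pwB` (pointwise extraction), **`lcsA ∕ lcsB` (local conditional stability — THE residual of Bałaban's
KIND)**, the window ledgers `ledgerA ∕ ledgerB` (price sentences at the derived quotients `exp Σ_{j<K} (b − a)`), the step-kernel identities and
the key-pattern readings — through `B16HistoryTowerExtractionEnd3.toPriced` (extraction displays DERIVED: `extractA_of_LCS ∕ extractB_of_LCS`;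
level measures `μ K K`): for some `K₁ ≥ Sd.K₀`, `K₂`, `RelWeightBound Sd.l₀ …` at the `(K₁ + K₂)`-shifted tower carriers, bad set and weight
VERBATIM as in §1.  So N20 ⇐ {LCS per pinned event, ledgers, kernels, readings} + `BetaPertHyp` + constants, with NO cell-count binder;
every input a hypothesis; nothing of Bałaban's asserted. [folklore] -/
theorem relWeightBound_of_towerExtractionStep_derived (D : FiniteEpsData F G) (hβ : BetaPertHyp D.βfun)
    {C : T4PrintedShapeBanking.Consts} {O : PrintedO1s}
    {rr : ℕ} {β₀ : ℝ} (h : ThresholdOK C F.L rr β₀) (hμ : 0 < C.μ) (d n : ℕ)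
    (hκ₁ : (d : ℝ) * Real.log F.L + 2 * Real.log 2 ≤ C.κ₁) (hE₀ : Real.log (2 + birthMass C) ≤ C.E₀)
    (hA₀ : 1 ≤ C.A₀) (hβ₀ : 0 < β₀) (hLβ : (F.L : ℝ) * β₀ ≤ 1) (hn₁ : 13 ≤ C.n₁) (hn : 0 < n)
    {θ : ℝ} (hθ : 0 < θ) (hslack : C.a + θ ≤ O.γ₀ * O.A₁ ^ 2 / 2)
    (hE₂ : 0 < C.E₂) (hE₃ : 0 ≤ C.E₃) {sS : ℕ} (hsS : 1 ≤ sS)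
    (hsmall : (((2 * cth 32 1 sS + 1) ^ d : ℕ) : ℝ) * (5 : ℝ) ^ d * ((max 1 (2 * 32 + 2) : ℕ) : ℝ) ≤
      (F.L : ℝ) ^ (sS / 2) / 2)
    {θc : ℝ} (hθc0 : 0 ≤ θc) (hθc1 : θc < 1) (hθcs : 1 / 2 ≤ θc ^ sS) :
    ∃ γ₁ : ℝ, 0 < γ₁ ∧ ∀ γ : ℝ, 0 < γ → γ ≤ γ₁ → ∃ g₁ : ℝ, 0 < g₁ ∧ ∀ g : ℝ, 0 < g → g ≤ g₁ →
      ∀ g₀ : ℕ → ℝ, D.Tuned γ g g₀ → ∀ (os : List (ULoop F))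
        {θv cΛ M Φ b₀ : ℝ} {p₁ η η' κ κ₂ κᵥ : ℕ} {P : Type} [DecidableEq P] {X : ℕ → ℕ → Type}
        {𝒢 : (K j : ℕ) → GoodClass (X K j)} [∀ K j, MeasurableSpace (X K j)] {μ : (K j : ℕ) → Measure (X K j)}
        [∀ K, IsFiniteMeasure (μ K K)]
        (Sd : TowerExtractionStepDataLWR D C O θv rr d n hn g₀ os cΛ M Φ b₀ p₁ η η' κ κ₂ κᵥ P X 𝒢 μ),
      ∃ K₁ K₂, Sd.K₀ ≤ K₁ ∧ RelWeightBound Sd.l₀ (fun K => HIndex.termSet (skelFam Sd.T Sd.p₀) (K₁ + (K₂ + K)))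
        (fun _ t => Repr172R.weight (fun K => μ K K) (reprFam Sd.T Sd.p₀ Sd.ρ₀ Sd.hρ₀ Sd.h0 (fun _ _ => 1) (fun _ _ => one_pos)) t)
        (fun K => weightB (fun K => μ K K) (reprFam Sd.T Sd.p₀ Sd.ρ₀ Sd.hρ₀ Sd.h0 (fun _ _ => 1) (fun _ _ => one_pos)) Sd.trunc
          (K₁ + (K₂ + K)))
        (fun K => badOfClass (bstrOf Prod.fst (memA n F.L (Sd.𝒮.reading Sd.T Sd.p₀))) (HIndex.termSet (skelFam Sd.T Sd.p₀))
            (fun K _ => badClasses Prod.fst (memA n F.L (Sd.𝒮.reading Sd.T Sd.p₀)) jhalf (HIndex.termSet (skelFam Sd.T Sd.p₀)) K)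
            (K₁ + (K₂ + K)))
        (fun K => 1 * recordsBudget (birthMass C) C.κ₁ ((n : ℝ) ^ d) ((F.L : ℝ) ^ d) (Real.log 2) jhalf (K₁ + (K₂ + K))) := by
  obtain ⟨γ₁, hγ₁, H⟩ := relWeightBound_of_towerExtractionPriced_derived D hβ h hμ d n hκ₁ hE₀ hA₀ hβ₀ hLβ hn₁ hn hθ hslack
    hE₂ hE₃ hsS hsmall hθc0 hθc1 hθcs
  refine ⟨γ₁, hγ₁, fun γ hγ hγle => ?_⟩
  obtain ⟨g₁, hg₁, Hg⟩ := H γ hγ hγle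
  exact ⟨g₁, hg₁, fun g hg hgle g₀ ht os θv cΛ M Φ b₀ p₁ η η' κ κ₂ κᵥ P _ X 𝒢 _ μ _ Sd =>
    Hg g hg hgle g₀ ht os (toPriced Sd)⟩

end Step


/-! ## §3 Guards (vacuity audit in kernel form): part 1's §1 knit is inhabited with a NONEMPTY bad class; the node statement is not for free -/

section Guards

open Literature.MathematicalPhysics.QuantumFieldTheory.Balaban1983to89.T4BadClassBooking (not_exists_relWeightBound_of_saturated)
open Summit.QuantumFields.BalabanUV.T4Continuum.NE7b.PinnedExtraction (ExtractionLaws ExtractionLaws.bad_le)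

/-- **GUARD 1a — `ExtractionLaws` INHABITED WITH A NONEMPTY BAD CLASS.**  Toy: two terms `true` (good, weight `1`) and `false` (bad, weight
`(1∕2)^{K+1}`) at every cutoff and every source, one pinned class `()` with sub-class `{false}` and quotient `(1∕2)^{K+1}`; the display reads
`(1∕2)^{K+1} ≤ (1∕2)^{K+1}·(1 + (1∕2)^{K+1})`. [folklore] -/
theorem extractionLaws_toy :
    ExtractionLaws (ι := Bool) (α := Unit) 1 (fun _ => Finset.univ)
      (fun K _ b => if b then (1 : ℝ) else (1 / 2 : ℝ) ^ (K + 1)) (fun _ _ => {false}) (fun _ => {()}) (fun _ _ => {false})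
      (fun K _ => (1 / 2 : ℝ) ^ (K + 1)) where
  bad_subset _ _ _ := Finset.subset_univ _
  cover _ _ _ τ hτ := ⟨(), Finset.mem_singleton_self _, hτ⟩
  q_nonneg K _ _ := by positivity
  extract K t _ x _ := by
    rw [Finset.sum_singleton, Fintype.sum_bool]
    simp only [if_true, Bool.false_eq_true, if_false]
    have h0 : (0 : ℝ) ≤ (1 / 2 : ℝ) ^ (K + 1) := by positivity
    nlinarith

/-- **GUARD 1b — THE SIDE CONDITIONS OF THE §1 KNIT HOLD ON THE TOY**: quotient total `= W K := (1∕2)^{K+1}`, `W K < 1` at EVERY `K`, `Σ W < ∞`,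
nonnegative weights. [folklore] -/
theorem toy_side_conditions :
    (∀ K : ℕ, ∑ x ∈ ({()} : Finset Unit), (fun (K : ℕ) (_ : Unit) => (1 / 2 : ℝ) ^ (K + 1)) K x ≤ (1 / 2 : ℝ) ^ (K + 1)) ∧
      (∀ K : ℕ, (1 / 2 : ℝ) ^ (K + 1) < 1) ∧ Summable (fun K : ℕ => (1 / 2 : ℝ) ^ (K + 1)) ∧
      (∀ (K : ℕ) (t : ℝ), |t| ≤ 1 → ∀ b : Bool, 0 ≤ (if b then (1 : ℝ) else (1 / 2 : ℝ) ^ (K + 1))) := by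
  refine ⟨fun K => by rw [Finset.sum_singleton], fun K => pow_lt_one₀ (by norm_num) (by norm_num) (Nat.succ_ne_zero K), ?_, ?_⟩
  · have hs := (summable_geometric_of_lt_one (by norm_num : (0 : ℝ) ≤ 1 / 2) (by norm_num)).mul_left (1 / 2 : ℝ)
    exact hs.congr fun K => by ring
  · intro K t _ b; cases b <;> simp only [if_true, Bool.false_eq_true, if_false] <;> positivity

/-- **GUARD 1c — HENCE `RelWeightBound` WITH THE BAD CLASS `{false}` AT EVERY CUTOFF** (both runs the toy family, weight `(1∕2)^{K+1}`): the
conclusion of part 1's `N20Knit.relWeightBound_of_extractionLaws` on the toy, assembled here from `extractionLaws_toy.bad_le` and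
`toy_side_conditions` (the same six fields). [folklore] -/
theorem relWeightBound_toy :
    RelWeightBound (ι := Bool) 1 (fun _ => Finset.univ) (fun K _ b => if b then (1 : ℝ) else (1 / 2 : ℝ) ^ (K + 1))
      (fun K _ b => if b then (1 : ℝ) else (1 / 2 : ℝ) ^ (K + 1)) (fun _ _ => {false}) (fun K => (1 / 2 : ℝ) ^ (K + 1)) := by
  obtain ⟨hq, h1, hs, hnn⟩ := toy_side_conditions
  have hle : ∀ (K : ℕ) (t : ℝ), |t| ≤ 1 →
      ∑ τ ∈ ({false} : Finset Bool), (if τ then (1 : ℝ) else (1 / 2 : ℝ) ^ (K + 1)) ≤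
        (1 / 2 : ℝ) ^ (K + 1) * ∑ τ ∈ (Finset.univ : Finset Bool), (if τ then (1 : ℝ) else (1 / 2 : ℝ) ^ (K + 1)) :=
    fun K t ht => (extractionLaws_toy.bad_le (fun K t ht τ => hnn K t ht τ) K t ht).trans
      (mul_le_mul_of_nonneg_right (hq K) (Finset.sum_nonneg fun τ _ => hnn K t ht τ))
  exact
    { bad_subset := fun _ _ _ => Finset.subset_univ _
      nonneg := fun K => by positivity
      lt_one := h1
      summable := hs
      bad_left := hle
      bad_right := hle }

/-- the toy's bad class is nonempty at every cutoff and source (Guard 1 is not the empty-class instance). [folklore] -/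
theorem toy_bad_nonempty (K : ℕ) (t : ℝ) : ((fun (_ : ℕ) (_ : ℝ) => ({false} : Finset Bool)) K t).Nonempty :=
  Finset.singleton_nonempty _

/-- **GUARD 2 — THE NODE STATEMENT IS NOT FOR FREE.**  On the same two-term family with the bad term's weight NOT decaying (`false ↦ 1`) the
bad class carries the fraction `1∕2` of the total at every cutoff — it is SATURATED (`T4BadClassBooking.Saturated`) — so NO weight sequence
`W` makes `RelWeightBound` hold, whatever the second run (`T4BadClassBooking.not_exists_relWeightBound_of_saturated` BY NAME): N20's content is
the SUMMABLE DECAY of the old classes' relative weight.  (The EMPTY class, by contrast, is free for any two runs —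
`T4LipschitzLedgerSocket.relWeightBound_noBad` —: the K5 record predicate must pin `S.Bad` to the budget's own saturated bad set.) [folklore] -/
theorem not_exists_relWeightBound_toy_saturated (B : ℕ → ℝ → Bool → ℝ) :
    ¬ ∃ W : ℕ → ℝ, RelWeightBound (ι := Bool) 1 (fun _ => Finset.univ) (fun _ _ _ => (1 : ℝ)) B (fun _ _ => {false}) W := by
  refine not_exists_relWeightBound_of_saturated (c := 1 / 2) (by norm_num) ?_
  refine Filter.Frequently.of_forall fun K => ⟨0, by norm_num, ?_, ?_⟩
  · rw [Fintype.sum_bool]; norm_num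
  · rw [Fintype.sum_bool, Finset.sum_singleton]; norm_num

/-- **GUARD 3 — THE RADIUS PIN IS LOAD-BEARING.**  With a NEGATIVE source radius `l₀ < 0` no `t` satisfies `|t| ≤ l₀`, so every `∀ t`-clause
of the node statement is vacuous and `RelWeightBound l₀ T A B Bad W` holds for ANY term families and ANY bad classes (not even `Bad ⊆ T` is
needed) as soon as `0 ≤ W < 1` is summable — the record predicate must pin `0 < S.l₀` (the tower records carry `l₀_pos`; Q8's `SpineDatum`
carries `0 < l₀` as a conjunct). [folklore] -/
theorem relWeightBound_of_radius_neg {ι : Type*} {l₀ : ℝ} (hl : l₀ < 0) (T : ℕ → Finset ι) (A B : ℕ → ℝ → ι → ℝ)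
    (Bad : ℕ → ℝ → Finset ι) {W : ℕ → ℝ} (h0 : ∀ K, 0 ≤ W K) (h1 : ∀ K, W K < 1) (hs : Summable W) :
    RelWeightBound l₀ T A B Bad W where
  bad_subset _ t ht := absurd (ht.trans_lt hl) (not_lt.2 (abs_nonneg t))
  nonneg := h0
  lt_one := h1
  summable := hs
  bad_left _ t ht := absurd (ht.trans_lt hl) (not_lt.2 (abs_nonneg t))
  bad_right _ t ht := absurd (ht.trans_lt hl) (not_lt.2 (abs_nonneg t))

end Guards

end Summit.QuantumFields.YangMills.BalabanUVNodes.N20KnitDerived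

end
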